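import Literature.AlgebraicGeometry.Frobenioids.ArithmeticFrobenioidFrobeniusCompact
import Literature.AlgebraicGeometry.Frobenioids.ArithmeticFrobenioidIsotropic
import Literature.AlgebraicGeometry.Frobenioids.ArithmeticFrobenioidStandard
import Literature.AlgebraicGeometry.Frobenioids.ModelFrobenioidFunctor
import Literature.AlgebraicGeometry.Frobenioids.EquivalenceTransportAnchors
import Literature.AlgebraicGeometry.Frobenioids.DivisorMonoidCategoryTheoreticityDefs
import HarnessLib

/-!
# Frobenioids I, Proposition 4.8 (iii) as the INTERFACE-typed schema `Prop48iii S R SI BI` (FACT-LIST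
# F-1050): the universal closure is false — junk operations / birationalization datum on `C^istr` of a
# GENUINE Frobenioid of rationally standard type (the arithmetic Frobenioid `C_{ℚ/ℚ}` of Thm. 6.4)

Mochizuki, *The geometry of Frobenioids I: the general theory*, Kyushu J. Math. **62** (2008)
293–400, §4, Proposition 4.8 (iii), kurims text p. 88: "If `C` is of rationally standard type, then
`(C^istr)^birat` is of standard type." [cite: MochizukiFrdI2008, Prop. 4.8 (iii) p.88]

PROOF-ONLY companion (cell abc-iut, block F fact-proving wave, seat abc-iut-f-025; FACT-LIST row
**F-1050** `PreFrobenioidData.Prop48iii`, labelled «universal-closure REFUTED / schema» by the R7 kernel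
TYPE-audit of abc-iut-w5-d199 WITHOUT a kernel object for the refutation) of
`DivisorMonoidCategoryTheoreticityDefs.lean` (seat abc-iut-L1-t3); twin of `Remark451SchemaNegative.lean`
(F-1052).

The typed `Prop48iii S R SI BI := S.IsOfRationallyStandardType R → BI.ops.IsOfStandardType` takes the
operations `SI` on `C^istr` AND the birationalization datum `BI : SI.BiratData` as FREE parameters, not
as the restriction of `S` and THE birationalization.  Its universal closure is therefore false as soon as
ONE pair `(S, R)` of rationally standard type exists in the tree — and it does: the arithmetic Frobenioid
`C_{K/F}` of [FrdI] Ex. 6.3 / Thm. 6.4 (abc-iut-L6-t10's `arithFrobenioid F K`) at THE Def. 4.5 (iii)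
parameters (`arithFrobenioid_isOfRationallyStandardType_rsParams`), which is moreover of isotropic type
(`isOfIsotropicType_arith`) and of standard type (`isOfStandardType_arith`), so that `C^istr = C` as the
full subcategory on ALL objects.  Witness: `SI` := zero divisors, all Frobenius degrees `1`, base
`C^istr → C → D`; `BI` := the identity datum over `SI` (`(C^istr)^birat := C^istr`, the same operations,
`Φ^birat := ⊤`, trivial divisor maps).  The degree-`2` Frobenius endomorphism of the zero object over the
bottom field (`ModelFrobenioid.frobeniusEndHom _ 2`) is an `SI`-isometric pre-step (base component the
identity) that is not invertible (degrees are multiplicative), so that object is NOT `SI`-isotropic; were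
`BI.ops = SI` of standard type, quasi-isotropy would make it an ISO-SUBANCHOR of `C^istr ≌ C`
(transport: abc-iut-L1's `IsIsoSubanchor.map_equivalence`), whereas `C` is quasi-isotropic with every
object isotropic:

* `arith_exists_junk_istrBiratData_not_standard` — the witness, for every number field `F` and Galois `K/F`;
* `PreFrobenioidData.not_forall_prop48iii` — the universal closure (universe `0`) is FALSE, at `F = K = ℚ`.

INSTANCE form (what consumers bind): abc-iut-L1-d5's
`PreFrobenioidData.prop48iii_rationallyStandard_unconditional` — Prop. 4.8 (iii) for EVERY Frobenioid at
THE Def. 4.5 (iii) parameters and THE birationalization of `C^istr`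
(`UnitTrivializationProp48iiiUnconditional.lean`).  So the row is admissible ONLY at that instance (R5).
Refuted-closure ≠ refuted-paper; no definitions; no statement of the paper is strengthened; nothing here
bears on [IUTchIII] Cor. 3.12.
-/

noncomputable section

namespace Literature.AlgebraicGeometry.Frobenioids

open CategoryTheory

/-! ### A morphism of a model Frobenioid of Frobenius degree `≠ 1` is not invertible -/

/-- In a model Frobenioid ([FrdI] Thm. 5.2) Frobenius degrees are multiplicative and the identity has
degree `1`, so a morphism of Frobenius degree `≠ 1` is not an isomorphism.
[cite: MochizukiFrdI2008, Thm. 5.2 (i) p.100] -/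
theorem ModelFrobenioid.not_isIso_of_degFr_ne_one {D : Type} [Category.{0} D]
    {Φ B : Dᵒᵖ ⥤ CommMonCat.{0}} {DivB : B ⟶ monoidGp Φ} {X Y : ModelFrobenioid Φ B DivB}
    (φ : X ⟶ Y) (h : ModelFrobenioid.degFr φ ≠ 1) : ¬ IsIso φ := by
  intro hφ
  have e : ModelFrobenioid.degFr (φ ≫ inv φ) = 1 := by
    rw [IsIso.hom_inv_id]
    rfl
  rw [ModelFrobenioid.degFr_comp] at e
  have e' := congrArg PNat.val e
  rw [PNat.mul_coe] at e'
  exact h (PNat.coe_injective ((Nat.eq_one_of_mul_eq_one_left e').trans PNat.one_coe.symm))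

/-! ### The witness: junk `C^istr`-operations and birationalization datum over `C_{K/F}` -/

section Arith

variable (F : Type) [Field F] [NumberField F] (K : Type) [Field K] [Algebra F K] [IsGalois F K]

/-- **A junk pair `(SI, BI)` against Prop. 4.8 (iii) as typed.**  Over the arithmetic Frobenioid
`C_{K/F}` (rationally standard at THE parameters, of isotropic and of standard type — Thm. 6.4 (i)) take on
`C^istr` (= all objects) the operations `SI` with zero divisors and all Frobenius degrees `1`, and the
identity birationalization datum `BI` over `SI`.  Then `BI.ops = SI` is NOT of standard type: the degree-`2`
Frobenius endomorphism of the zero object over the bottom field is an `SI`-isometric pre-step that is not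
invertible, and the object is no iso-subanchor of `C^istr ≌ C`. [cite: MochizukiFrdI2008, Prop. 4.8 (iii) p.88] -/
theorem arith_exists_junk_istrBiratData_not_standard :
    ∃ (SI : PreFrobenioidData.{0} (arithFrobenioidOps F K).Istr (FinSubextCat F K))
      (BI : PreFrobenioidData.BiratData.{0, 0, 0, 0, 0, 0} SI),
      (arithFrobenioidOps F K).IsOfRationallyStandardType
          (PreFrobenioid.rsParams (arithFrobenioid_isFrobenioid F K) fun a 𝔭 => PrimarySupp a 𝔭) ∧
        ¬ BI.ops.IsOfStandardType := by
  let S₀ : PreFrobenioidData.{0} (arithFrobenioid F K) (FinSubextCat F K) := arithFrobenioidOps F K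
  have hiso : S₀.IsOfIsotropicType := isOfIsotropicType_arith F K
  have hstd : S₀.IsOfStandardType := isOfStandardType_arith F K
  -- the junk operations on `C^istr`
  let SI : PreFrobenioidData.{0} S₀.Istr (FinSubextCat F K) :=
    { base := S₀.istrι ⋙ S₀.base
      Mon := fun _ => PUnit
      pull := fun _ => MonoidHom.id _
      pull_id := fun _ _ => rfl
      pull_comp := fun _ _ _ => rfl
      div := fun _ => 1
      degFr := fun _ => 1
      div_id := fun _ => rfl
      div_comp := fun _ _ => rfl
      degFr_id := fun _ => rfl
      degFr_comp := fun _ _ => (mul_one _).symm }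
  -- the identity birationalization datum over `SI`
  let BI : PreFrobenioidData.BiratData.{0, 0, 0, 0, 0, 0} SI :=
    { Birat := S₀.Istr
      toBirat := 𝟭 _
      obj_surjective := fun X => ⟨X, rfl⟩
      ops := SI
      ops_mon_eq_one := fun _ _ => rfl
      overBase := (S₀.istrι ⋙ S₀.base).leftUnitor
      phiBirat := fun _ => ⊤
      divBirat := fun _ => 1
      divBirat_mem := fun _ _ => Subgroup.mem_top _ }
  refine ⟨SI, BI, arithFrobenioid_isOfRationallyStandardType_rsParams F K, fun hSI => ?_⟩
  -- the zero object over the bottom field and its degree-`2` Frobenius endomorphism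
  let X₀ : FinSubextCat F K := ⟨⊥⟩
  let Z : arithFrobenioid F K := ModelFrobenioid.zeroObj _ _ _ X₀
  let φ₂ : Z ⟶ Z := ModelFrobenioid.frobeniusEndHom (Φ := arithDivisorFunctor F K)
    (B := unitsFunctor F K) (DivB := divNatTrans F K) X₀ 2
  let A₀ : S₀.Istr := ⟨Z, hiso.obj _⟩
  let φ : A₀ ⟶ A₀ := ObjectProperty.homMk φ₂
  -- `φ` is an `SI`-isometric pre-step (its base component is the identity) …
  have hφ : SI.IsIsometricPreStep φ := by
    refine ⟨⟨rfl, ?_⟩, rfl⟩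
    show IsIso (S₀.base.map φ₂)
    exact (inferInstance : IsIso (𝟙 X₀))
  -- … but not an isomorphism: it has Frobenius degree `2`
  have hnot : ¬ IsIso φ := by
    intro h
    exact ModelFrobenioid.not_isIso_of_degFr_ne_one φ₂
      (fun e => absurd (show (2 : ℕ+) = 1 from e) (by decide)) (inferInstance : IsIso φ.hom)
  -- hence `A₀` is not `SI`-isotropic, so by `SI`-quasi-isotropy it is an iso-subanchor of `C^istr`
  have hA₀ : IsIsoSubanchor A₀ :=
    (hSI.quasiIsotropic.nonIsotropic_iff A₀).mp fun h => hnot (h φ hφ)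
  -- transport along the equivalence `C^istr ≌ C` (every object is isotropic)
  haveI : S₀.istrι.EssSurj := ⟨fun Y => ⟨⟨Y, hiso.obj Y⟩, ⟨Iso.refl _⟩⟩⟩
  haveI : S₀.istrι.IsEquivalence := {}
  have hC : IsIsoSubanchor Z := hA₀.map_equivalence S₀.istrι.asEquivalence
  -- but `C` is quasi-isotropic and `Z` is isotropic: contradiction
  exact (hstd.quasiIsotropic.nonIsotropic_iff Z).mpr hC (hiso.obj _)

end Arith

/-! ### The fully quantified closure, refuted at `C_{ℚ/ℚ}` -/

/-- **FACT-LIST F-1050, universal closure REFUTED** (universe `0`; witness: `S` = the operations of the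
arithmetic Frobenioid `C_{ℚ/ℚ}`, `R` = THE Def. 4.5 (iii) parameters, `(SI, BI)` = the junk pair of
`arith_exists_junk_istrBiratData_not_standard`).  The printed Prop. 4.8 (iii) is the instance at THE
restricted operations and THE birationalization of `C^istr`, PROVED for every Frobenioid
(`PreFrobenioidData.prop48iii_rationallyStandard_unconditional`).
[cite: MochizukiFrdI2008, Prop. 4.8 (iii) p.88] -/
theorem PreFrobenioidData.not_forall_prop48iii :
    ¬ ∀ (C : Type) [Category.{0} C] (D : Type) [Category.{0} D] (S : PreFrobenioidData.{0} C D)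
        (R : PreFrobenioidData.RSParams.{0, 0, 0, 0, 0, 0} S) (SI : PreFrobenioidData.{0} S.Istr D)
        (BI : PreFrobenioidData.BiratData.{0, 0, 0, 0, 0, 0} SI),
        Literature.AlgebraicGeometry.Frobenioids.PreFrobenioidData.Prop48iii S R SI BI := by
  intro h
  obtain ⟨SI, BI, hR, hBI⟩ := arith_exists_junk_istrBiratData_not_standard ℚ ℚ
  exact hBI (h _ _ (arithFrobenioidOps ℚ ℚ) _ SI BI hR)

end Literature.AlgebraicGeometry.Frobenioids

end
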